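import Summits.QuantumFields.BalabanUV.T4Continuum.Support.ChainEndWords
import Summits.QuantumFields.BalabanUV.T4Continuum.Support.GaugeFieldPerturbation
import HarnessLib

/-!
# T⁴ programme, node NE3 — the kinematic refinement lemma, leaf R2b item (f): TRANSPORT OF THE CHAIN-END
# MODIFICATION (unitarity, periodicity, small-field radius, pointwise flux gradient)

NE3 formalisation swarm of the cell `pub-balaban` (unit `b2b-balaban-t4-ne3-formalise-leaf-04`), the residual item (f)
of `t4/formal/NE3/LEAVES.md` row S4a′ after the row owner `b2b-balaban-t4-ne3-p1` landed the word combinatorics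
(`Support/ChainEndWords`, p210038: `modify L W c` right-multiplies the chain-end bond of every `L`-bond `(z, μ)` by
`c z μ`) and the per-bond contraction (`Support/ChainEndContraction`, p209730), and the glue seat landed the generic
perturbation toolkit (`Support/GaugeFieldPerturbation`, p210483: a bond-wise `ρ`-modification of a unitary configuration
moves the small-field radius by `≤ 4ρ` and a pointwise flux-gradient bound by `≤ 18ρ`).

## What this file adds (all [folklore] bookkeeping; nothing is an estimate of the series)

§1 THE CHAIN-END STRUCTURE IS `L`-PERIODIC (group-valued configurations): `IsChainEnd` is invariant and `chainIndex`
covariant under fine translations by `L·M·e_ι` (`isChainEnd_add_smul_iff`, `chainIndex_add_smul`), hence `W` of fine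
period `L·M` and a coarse field `c` of period `M` give a modified configuration of fine period `L·M` (`modify_add_smul`)
— what the owner's `ChainEndFix.corrField_shift` (periodic data ⇒ periodic corrections) feeds.
§2 IN THE `U(N)` VOCABULARY OF `T4AveragingDeficitWall`: `isUnitaryCfg_modify`, `isPeriodicCfg_modify` (period `L·M`
from `IsPeriodicCfg W (L·M)` and `IsPeriodicCfg c M`), `norm_modify_sub_le` (`‖W_c(b) − W(b)‖ ≤ ρ` on every fine bond from
`‖c z μ − 1‖ ≤ ρ`), and — by the toolkit p210483 BY NAME — **`smallField_modify`** (`SmallField W a → SmallField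
(modify L W c) (a + 4ρ)`) and **`covGrad_flux_modify`** (pointwise `‖∇F‖ ≤ g ⇒ ≤ g + 18ρ` for the modified field, under
`a + 4ρ ≤ 1/2`); §3 the four facts bundled as `modify_regularData` for the glue R0 (skeleton §3 R0: `b′ = b₁ + 2KmL³`-type
bookkeeping, here with the toolkit's constants `4` and `18`).

HONEST FRAMING.  Kinematic bookkeeping about Bałaban's block average (42) ([Balaban1985Averaging] p. 23) and the
chain-end modification; no minimiser, no estimate of the series, no conditional of the cell (`BetaPertH`, (B), (B^μ)) is
used or hidden; nothing bears on infinite volume, a mass gap, or the Clay problem; **NE3 is NOT proved** (this serves leaf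
R2 of the kinematic lemma `SmoothRefine`; NE3-(A) stays CONDITIONAL on ⟨`SandwichData`⟩ ∕ ⟨(H1), (H3ˢᵘᵖ), (H0),
`SmoothRefine`⟩ BY NAME).  ABSOLUTE RULE of the cell kept: no printed sentence is a hypothesis of any declaration; no
`def … : Prop` fact; no `sorry`, no axioms beyond Mathlib's.  PLACEMENT (human rule 2026-08-19): cell work under
`Summits/QuantumFields/BalabanUV/`; imports the tree's `Support/ChainEndWords` and `Support/GaugeFieldPerturbation`
only; restates nothing of them; moves nothing.  Records: LEAVES.md row S4a′ (f); CLAIMS.log «NE3-(s4a′)» l.7021∕7027,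
ACK∕residual l.7342 of the cell `pub-balaban`.
-/

set_option autoImplicit false

open scoped BigOperators Matrix Matrix.Norms.L2Operator
open NormedSpace

namespace Summit.QuantumFields.BalabanUV.T4Continuum.ChainEndTransport

open Literature.MathematicalPhysics.QuantumFieldTheory.Balaban1983to89
open B7Prop1Explicit B7Prop2Explicit UnitaryModel
open T4AveragingDeficitWall (IsUnitaryCfg SmallField flux covGrad)
open T4AveragingDeficitWallBoundary (IsPeriodicCfg)
open ChainEndWords (IsChainEnd chainIndex modify_mem)
open GaugeFieldPerturbation (smallField_perturb covGrad_flux_perturb)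

variable {d : ℕ} (L : ℕ)

/-! ## §1 The chain-end structure is `L`-periodic -/

section Group

variable {G : Type*} [Group G]

/-- Chain ends are invariant under fine translations by `L·M·e_ι`. [folklore] -/
theorem isChainEnd_add_smul_iff (y : Site d) (μ ι : Fin d) (M : ℤ) :
    IsChainEnd L (y + ((L : ℤ) * M) • e ι) μ ↔ IsChainEnd L y μ := by
  unfold IsChainEnd
  refine forall_congr' fun ν => ?_
  have : (y + ((L : ℤ) * M) • e ι + e μ) ν = (L : ℤ) * (M * e ι ν) + (y + e μ) ν := by
    simp only [Pi.add_apply, Pi.smul_apply, smul_eq_mul]; ring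
  rw [this]
  exact dvd_add_right (dvd_mul_right _ _)

/-- The coarse index shifts by `M·e_ι` under fine translations by `L·M·e_ι` (`L ≥ 1`). [folklore] -/
theorem chainIndex_add_smul (hL : 1 ≤ L) (y : Site d) (μ ι : Fin d) (M : ℤ) :
    chainIndex L (y + ((L : ℤ) * M) • e ι) μ = chainIndex L y μ + M • e ι := by
  have hL0 : (L : ℤ) ≠ 0 := by exact_mod_cast (by omega : L ≠ 0)
  ext ν
  simp only [chainIndex, Pi.add_apply, Pi.smul_apply, smul_eq_mul]
  rw [show y ν + (L : ℤ) * M * e ι ν + e μ ν = (y ν + e μ ν) + (M * e ι ν) * (L : ℤ) by ring,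
    Int.add_mul_ediv_right _ _ hL0]
  ring

/-- **PERIODICITY TRANSPORT**: `W` of fine period `L·M` and `c` of coarse period `M` (in direction `ι`) give
`modify L W c` of fine period `L·M` (`L ≥ 1`). [folklore] -/
theorem modify_add_smul (hL : 1 ≤ L) {W c : Site d → Fin d → G} {M : ℤ}
    (hW : ∀ (x : Site d) (ι μ : Fin d), W (x + ((L : ℤ) * M) • e ι) μ = W x μ)
    (hc : ∀ (z : Site d) (ι μ : Fin d), c (z + M • e ι) μ = c z μ) (y : Site d) (ι μ : Fin d) :
    ChainEndWords.modify L W c (y + ((L : ℤ) * M) • e ι) μ = ChainEndWords.modify L W c y μ := by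
  unfold ChainEndWords.modify
  by_cases h : IsChainEnd L y μ
  · rw [if_pos ((isChainEnd_add_smul_iff L y μ ι M).mpr h), if_pos h, chainIndex_add_smul L hL, hc, hW]
  · rw [if_neg (mt (isChainEnd_add_smul_iff L y μ ι M).mp h), if_neg h, hW]

end Group

/-! ## §2 In the `U(N)` vocabulary: unitarity, periodicity, bond-wise size, small field, flux gradient -/

section Unitary

variable {n : Type*} [Fintype n] [DecidableEq n]

/-- **UNITARITY TRANSPORT**: `modify L W c` is `U(N)`-valued if `W` and `c` are. [folklore] -/
theorem isUnitaryCfg_modify {W c : Site d → Fin d → (Matrix n n ℂ)ˣ} (hW : IsUnitaryCfg W) (hc : IsUnitaryCfg c) :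
    IsUnitaryCfg (ChainEndWords.modify L W c) :=
  fun y μ => modify_mem hW hc y μ

/-- **PERIODICITY TRANSPORT** in the torus vocabulary: `IsPeriodicCfg W (L·M)` and `IsPeriodicCfg c M` give
`IsPeriodicCfg (modify L W c) (L·M)` (`L ≥ 1`). [folklore] -/
theorem isPeriodicCfg_modify (hL : 1 ≤ L) {W c : Site d → Fin d → (Matrix n n ℂ)ˣ} {M : ℕ}
    (hW : IsPeriodicCfg W ((L * M : ℕ) : ℤ)) (hc : IsPeriodicCfg c (M : ℤ)) :
    IsPeriodicCfg (ChainEndWords.modify L W c) ((L * M : ℕ) : ℤ) := by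
  intro y ι μ
  have hLM : ((L * M : ℕ) : ℤ) = (L : ℤ) * (M : ℤ) := by push_cast; ring
  rw [hLM]
  refine modify_add_smul L hL (M := (M : ℤ)) (fun x ι' μ' => ?_) (fun z ι' μ' => hc z ι' μ') y ι μ
  rw [← hLM]; exact hW x ι' μ'

/-- **BOND-WISE SIZE OF THE MODIFICATION**: `‖W_c(b) − W(b)‖ ≤ ρ` on every fine bond, for `U(N)`-valued `W` and
`‖c z μ − 1‖ ≤ ρ`. [folklore] -/
theorem norm_modify_sub_le [Nonempty n] {W c : Site d → Fin d → (Matrix n n ℂ)ˣ} (hW : IsUnitaryCfg W) {ρ : ℝ} (hρ : 0 ≤ ρ)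
    (hc : ∀ (z : Site d) (μ : Fin d), ‖((c z μ : (Matrix n n ℂ)ˣ) : Matrix n n ℂ) - 1‖ ≤ ρ) (y : Site d) (μ : Fin d) :
    ‖((ChainEndWords.modify L W c y μ : (Matrix n n ℂ)ˣ) : Matrix n n ℂ) - ((W y μ : (Matrix n n ℂ)ˣ) : Matrix n n ℂ)‖ ≤ ρ := by
  unfold ChainEndWords.modify
  split_ifs with h
  · have h1 : ((W y μ * c (chainIndex L y μ) μ : (Matrix n n ℂ)ˣ) : Matrix n n ℂ) - ((W y μ : (Matrix n n ℂ)ˣ) : Matrix n n ℂ)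
        = ((W y μ : (Matrix n n ℂ)ˣ) : Matrix n n ℂ) * (((c (chainIndex L y μ) μ : (Matrix n n ℂ)ˣ) : Matrix n n ℂ) - 1) := by
      rw [Units.val_mul, mul_sub, mul_one]
    rw [h1]
    calc ‖((W y μ : (Matrix n n ℂ)ˣ) : Matrix n n ℂ) * (((c (chainIndex L y μ) μ : (Matrix n n ℂ)ˣ) : Matrix n n ℂ) - 1)‖
        ≤ ‖((W y μ : (Matrix n n ℂ)ˣ) : Matrix n n ℂ)‖ * ‖((c (chainIndex L y μ) μ : (Matrix n n ℂ)ˣ) : Matrix n n ℂ) - 1‖ := norm_mul_le _ _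
      _ ≤ 1 * ρ := by
          gcongr
          · exact (mem_U1.mp (AveragingDeficitTransport.mem_U1_of_unitary (hW y μ))).1
          · exact hc _ μ
      _ = ρ := one_mul ρ
  · simpa using hρ

/-- **SMALL-FIELD TRANSPORT**: `SmallField W a → SmallField (modify L W c) (a + 4ρ)` for `U(N)`-valued `W`, `c` with
`‖c z μ − 1‖ ≤ ρ` (the toolkit's `smallField_perturb` BY NAME). [folklore] -/
theorem smallField_modify [Nonempty n] {W c : Site d → Fin d → (Matrix n n ℂ)ˣ} (hW : IsUnitaryCfg W) (hcU : IsUnitaryCfg c)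
    {ρ a : ℝ} (hρ : 0 ≤ ρ) (hc : ∀ (z : Site d) (μ : Fin d), ‖((c z μ : (Matrix n n ℂ)ˣ) : Matrix n n ℂ) - 1‖ ≤ ρ)
    (hS : SmallField W a) : SmallField (ChainEndWords.modify L W c) (a + 4 * ρ) :=
  smallField_perturb hW (isUnitaryCfg_modify L hW hcU) (norm_modify_sub_le L hW hρ hc) hS

/-- **FLUX-GRADIENT TRANSPORT**: a pointwise bound `‖∇_W F‖ ≤ g` becomes `‖∇_{W_c} F_c‖ ≤ g + 18ρ` for the modified
configuration, under `a + 4ρ ≤ 1/2` (the toolkit's `covGrad_flux_perturb` BY NAME). [folklore] -/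
theorem covGrad_flux_modify [Nonempty n] {W c : Site d → Fin d → (Matrix n n ℂ)ˣ} (hW : IsUnitaryCfg W) (hcU : IsUnitaryCfg c)
    {ρ a g : ℝ} (hρ : 0 ≤ ρ) (hc : ∀ (z : Site d) (μ : Fin d), ‖((c z μ : (Matrix n n ℂ)ˣ) : Matrix n n ℂ) - 1‖ ≤ ρ)
    (hS : SmallField W a) (har : a + 4 * ρ ≤ 1 / 2)
    (hg : ∀ (x : Site d) (κ : Fin d) (π : T4AveragingDeficitWall.Plane d), ‖covGrad W (flux W) x κ π‖ ≤ g)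
    (x : Site d) (κ : Fin d) (π : T4AveragingDeficitWall.Plane d) :
    ‖covGrad (ChainEndWords.modify L W c) (flux (ChainEndWords.modify L W c)) x κ π‖ ≤ g + 18 * ρ :=
  covGrad_flux_perturb hW (isUnitaryCfg_modify L hW hcU) hρ (norm_modify_sub_le L hW hρ hc) hS har hg x κ π

/-! ## §3 The bundle for the glue R0 -/

/-- **TRANSPORT OF THE CHAIN-END MODIFICATION, BUNDLED** (what the glue R0 reads off a chain-end fix of size `ρ`):
for `U(N)`-valued `W` of fine period `L·M` in `SmallField W a` with pointwise flux gradient `≤ g`, and a `U(N)`-valued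
coarse field `c` of period `M` with `‖c z μ − 1‖ ≤ ρ`, `a + 4ρ ≤ 1/2`, `L ≥ 1`: the modified configuration is
`U(N)`-valued, `(L·M)`-periodic, in `SmallField · (a + 4ρ)`, with pointwise flux gradient `≤ g + 18ρ`. [folklore] -/
theorem modify_regularData [Nonempty n] (hL : 1 ≤ L) {W c : Site d → Fin d → (Matrix n n ℂ)ˣ} {M : ℕ} (hW : IsUnitaryCfg W)
    (hWp : IsPeriodicCfg W ((L * M : ℕ) : ℤ)) (hcU : IsUnitaryCfg c) (hcp : IsPeriodicCfg c (M : ℤ)) {ρ a g : ℝ}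
    (hρ : 0 ≤ ρ) (hc : ∀ (z : Site d) (μ : Fin d), ‖((c z μ : (Matrix n n ℂ)ˣ) : Matrix n n ℂ) - 1‖ ≤ ρ) (hS : SmallField W a)
    (har : a + 4 * ρ ≤ 1 / 2)
    (hg : ∀ (x : Site d) (κ : Fin d) (π : T4AveragingDeficitWall.Plane d), ‖covGrad W (flux W) x κ π‖ ≤ g) :
    IsUnitaryCfg (ChainEndWords.modify L W c) ∧ IsPeriodicCfg (ChainEndWords.modify L W c) ((L * M : ℕ) : ℤ) ∧
      SmallField (ChainEndWords.modify L W c) (a + 4 * ρ) ∧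
      ∀ (x : Site d) (κ : Fin d) (π : T4AveragingDeficitWall.Plane d),
        ‖covGrad (ChainEndWords.modify L W c) (flux (ChainEndWords.modify L W c)) x κ π‖ ≤ g + 18 * ρ :=
  ⟨isUnitaryCfg_modify L hW hcU, isPeriodicCfg_modify L hL hWp hcp, smallField_modify L hW hcU hρ hc hS,
    covGrad_flux_modify L hW hcU hρ hc hS har hg⟩

end Unitary

end Summit.QuantumFields.BalabanUV.T4Continuum.ChainEndTransport
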